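import Mathlib.Data.EReal.Basic
import Literature.Probability.RandomPlanarGeometry.WholePlaneSLE
import Literature.Probability.RandomPlanarGeometry.RadialLoewnerChain
import HarnessLib

/-!
# The whole-plane Loewner chain: the interior (disc) picture — definitions

Topic `Probability/RandomPlanarGeometry`. Vocabulary for the proof of the named fact
`WholePlaneLoewnerChain.exists_unique` (`WholePlaneSLE`; G. F. Lawler, *Conformally Invariant
Processes in the Plane* (2005), §4.3, Prop. 4.21). Following Lawler's Remark 4.22 ("there is no
real difference between the whole-plane Loewner equation and the radial Loewner equation. One gets
from one to the other by the map `z ↦ 1/z`") and Miller–Sheffield (2013), §2.1.3, we work in the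
**interior picture**: if `gₜ` solves the whole-plane equation
`ġ = g (W + g)/(W - g)`, `W = e^{iλ}` (`WholePlaneLoewner.field`), then `kₜ(w) = 1/gₜ(1/w)` solves
the radial equation in the unit disc
```
  k̇ = k (ξ + k)/(ξ - k),   ξₜ = e^{-iλₜ} = W̄ₜ        (`dfield`, `drivingPt`)
```
(`inv_field_eq`), which for times `t ≥ b` is the radial Loewner equation of `RadialLoewnerChain`
(`RadialLoewner.Disc.field`) driven by the shifted driver `u ↦ -λ(b + u)` (`shiftDriver`,
`dfield_eq_disc_field`); and the asymptotic initial condition `eᵗ gₜ(z) → z` (`t → -∞`) becomes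
`e^{-t} kₜ(w) → w`. Writing `kₜ = eᵗ mₜ` the equation for `m` is `ṁ = kernel λ t m` with
`kernel λ t m = 2eᵗ m²/(ξₜ - eᵗ m)` (`dfield_exp_mul`), exponentially small as `t → -∞` — the
backward Volterra equation of `WholePlaneLoewnerVolterra`.

Definitions (all real, with bodies; the theory is in the sibling `WholePlaneLoewner*` files):

* `drivingPt λ t = e^{-iλₜ}`, `shiftDriver λ b`, `dfield λ t k`, `kernel λ t m`;
* `IsTraj λ w k T` — `k : ℝ → ℂ` is a **trajectory of `w` with lifetime `T : EReal`**: it solves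
  `k̇ = dfield λ t k` and stays in the open unit disc at all real times `t < T`, and
  `e^{-t} k t → w` as `t → -∞`;
* `lifetime λ w` — the supremum of the lifetimes of trajectories of `w` (the **swallowing time** of
  `w`, in `EReal`; `⊤` for `w = 0`), `traj λ w` — the maximal trajectory (by choice; junk value `0`
  after the lifetime), `discDomain λ t = {w | t < lifetime λ w}`;
* the exterior (whole-plane) objects: `hull λ t = {0} ∪ {z | lifetime λ z⁻¹ ≤ t}` and
  `map λ t z = (traj λ z⁻¹ t)⁻¹`.

## References

* G. F. Lawler, *Conformally Invariant Processes in the Plane*, AMS (2005), §4.3, Prop. 4.21,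
  Remark 4.22 [Lawler2005].
* J. Miller, S. Sheffield, *Imaginary geometry IV*, PTRF 169 (2017), arXiv:1302.4738, §2.1.3
  ("(2.5) is the same as (2.2)") [MillerSheffield2013].
-/

noncomputable section

open Set Filter Complex
open scoped Topology NNReal

namespace Literature.Probability.RandomPlanarGeometry

namespace WholePlaneLoewner

variable (lam : ℝ → ℝ)

/-! ### The interior driving point and the interior field -/

/-- The **interior driving point** `ξₜ = e^{-iλₜ} = W̄ₜ` on the unit circle (the image of the
whole-plane driving point `Wₜ = e^{iλₜ}` under `z ↦ 1/z̄`, i.e. its complex conjugate).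
Lawler (2005), (4.24) and Remark 4.22. [cite: Lawler2005, Remark 4.22] -/
def drivingPt (t : ℝ) : ℂ := exp (-(lam t : ℂ) * I)

/-- The **shifted driver** `u ↦ -λ(b + u)` on `ℝ≥0`: the driving function of the radial Loewner
chain (`RadialLoewnerChain`, driving point `e^{iU}`) that the interior picture follows from time
`b` on. [folklore] -/
def shiftDriver (b : ℝ) : ℝ≥0 → ℝ := fun u ↦ -lam (b + u)

/-- The **interior (radial) field** `dfield λ t k = k (ξₜ + k)/(ξₜ - k)` (junk value by `x/0 = 0`
at `k = ξₜ`). Lawler (2005), (4.11)/(4.24); Miller–Sheffield (2013), (2.2). [cite: Lawler2005, Remark 4.22] -/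
def dfield (t : ℝ) (k : ℂ) : ℂ := k * (drivingPt lam t + k) / (drivingPt lam t - k)

/-- The **Volterra kernel** of the interior picture: with `kₜ = eᵗ mₜ` the interior equation reads
`ṁ = kernel λ t m = 2 eᵗ m² / (ξₜ - eᵗ m)`. [folklore] -/
def kernel (t : ℝ) (m : ℂ) : ℂ :=
  2 * Real.exp t * m ^ 2 / (drivingPt lam t - Real.exp t * m)

/-! ### Trajectories from `-∞`, lifetimes, the maximal trajectory -/

/-- `IsTraj λ w k T`: **`k` is an interior trajectory of `w` with lifetime `T`** — at every real
time `t < T` it solves `k̇ = dfield λ t k` and lies in the open unit disc, and it has the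
asymptotic initial value `e^{-t} k t → w` as `t → -∞` (Lawler (2005), Prop. 4.21:
"`gₜ(z) ∼ e^{-α(t)} z` as `t → -∞`", read through `k = 1/g(1/·)`). [cite: Lawler2005, Prop. 4.21] -/
def IsTraj (w : ℂ) (k : ℝ → ℂ) (T : EReal) : Prop :=
  (∀ t : ℝ, (t : EReal) < T → HasDerivAt k (dfield lam t (k t)) t) ∧
    (∀ t : ℝ, (t : EReal) < T → ‖k t‖ < 1) ∧
      Tendsto (fun t : ℝ ↦ (Real.exp (-t) : ℂ) * k t) atBot (𝓝 w)

/-- The **lifetime** (swallowing time) of `w`: the supremum in `EReal` of the lifetimes of its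
trajectories. Lawler (2005), §4.2–4.3. [cite: Lawler2005, §4.3] -/
def lifetime (w : ℂ) : EReal :=
  sSup {T | ∃ k, IsTraj lam w k T}

open Classical in
/-- The **maximal trajectory** `traj λ w : ℝ → ℂ` of `w`: at a time `t` before the lifetime of some
trajectory of `w`, its value there (well defined by uniqueness of trajectories, proved in
`WholePlaneLoewnerTrajectory`); the documented junk value `0` otherwise. [cite: Lawler2005, Prop. 4.21] -/
def traj (w : ℂ) (t : ℝ) : ℂ :=
  if h : ∃ p : (ℝ → ℂ) × EReal, IsTraj lam w p.1 p.2 ∧ (t : EReal) < p.2 then h.choose.1 t else 0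

/-- The **interior domain** at time `t`: the points whose lifetime exceeds `t` (the domain of the
conformal map `kₜ = traj λ · t` onto the unit disc). [cite: Lawler2005, §4.3] -/
def discDomain (t : ℝ) : Set ℂ := {w | (t : EReal) < lifetime lam w}

/-! ### The exterior (whole-plane) objects -/

/-- The **whole-plane hull** `Kₜ = {0} ∪ {z | lifetime λ z⁻¹ ≤ t}`: the origin together with the
points `z` whose interior image `1/z` is swallowed by time `t`. Lawler (2005), §4.3.
[cite: Lawler2005, Prop. 4.21] -/
def hull (t : ℝ) : Set ℂ := {z | z = 0 ∨ lifetime lam z⁻¹ ≤ (t : EReal)}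

/-- The **whole-plane Loewner map** `gₜ(z) = 1 / k_t(1/z)` (meaningful off the hull).
Lawler (2005), §4.3, Remark 4.22. [cite: Lawler2005, Prop. 4.21] -/
def map (t : ℝ) (z : ℂ) : ℂ := (traj lam z⁻¹ t)⁻¹

/-! ### Unfolding lemmas and algebra -/

variable {lam}

/-- Unfolding of `drivingPt`. [folklore] -/
theorem drivingPt_apply (t : ℝ) : drivingPt lam t = exp (-(lam t : ℂ) * I) := rfl

/-- `|ξₜ| = 1`. [folklore] -/
@[simp] theorem norm_drivingPt (t : ℝ) : ‖drivingPt lam t‖ = 1 := by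
  rw [drivingPt_apply, show (-(lam t : ℂ) * I) = ((-lam t : ℝ) : ℂ) * I by push_cast; ring]
  exact norm_exp_ofReal_mul_I _

/-- `ξₜ ≠ 0`. [folklore] -/
theorem drivingPt_ne_zero (t : ℝ) : drivingPt lam t ≠ 0 := exp_ne_zero _

/-- `ξₜ W̄ₜ`-relation: `ξₜ · e^{iλₜ} = 1`. [folklore] -/
theorem drivingPt_mul_exp (t : ℝ) : drivingPt lam t * exp ((lam t : ℂ) * I) = 1 := by
  rw [drivingPt_apply, ← exp_add]
  simp [neg_mul]

/-- The interior driving point is continuous for a continuous driving function. [folklore] -/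
theorem continuous_drivingPt (hlam : Continuous lam) : Continuous (drivingPt lam) :=
  continuous_exp.comp ((continuous_ofReal.comp hlam).neg.mul continuous_const)

/-- A point of the open unit disc is off the driving point. [folklore] -/
theorem ne_drivingPt_of_norm_lt_one {k : ℂ} (hk : ‖k‖ < 1) (t : ℝ) : k ≠ drivingPt lam t := by
  rintro rfl
  simp at hk

/-- Unfolding of `shiftDriver`. [folklore] -/
@[simp] theorem shiftDriver_apply (b : ℝ) (u : ℝ≥0) : shiftDriver lam b u = -lam (b + u) := rfl

/-- The shifted driver of a continuous driving function is continuous. [folklore] -/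
theorem continuous_shiftDriver (hlam : Continuous lam) (b : ℝ) : Continuous (shiftDriver lam b) :=
  (hlam.comp (continuous_const.add NNReal.continuous_coe)).neg

/-- The radial driving point of the shifted driver at time `u ≥ 0` is `ξ_{b+u}`. [folklore] -/
theorem disc_drivingPt_shiftDriver (b : ℝ) {u : ℝ} (hu : 0 ≤ u) :
    RadialLoewner.Disc.drivingPt (shiftDriver lam b) u = drivingPt lam (b + u) := by
  rw [RadialLoewner.Disc.drivingPt_apply, drivingPt_apply, shiftDriver_apply,
    Real.coe_toNNReal _ hu]
  push_cast
  ring_nf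

/-- Unfolding of `dfield`. [folklore] -/
theorem dfield_apply (t : ℝ) (k : ℂ) :
    dfield lam t k = k * (drivingPt lam t + k) / (drivingPt lam t - k) := rfl

/-- The origin is a fixed point of the interior field. [folklore] -/
@[simp] theorem dfield_zero (t : ℝ) : dfield lam t 0 = 0 := by simp [dfield_apply]

/-- **The interior field is the radial field of the shifted driver**: for `u ≥ 0`,
`dfield λ (b + u) = RadialLoewner.Disc.field (shiftDriver λ b) u`. [folklore] -/
theorem dfield_eq_disc_field (b : ℝ) {u : ℝ} (hu : 0 ≤ u) (k : ℂ) :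
    dfield lam (b + u) k = RadialLoewner.Disc.field (shiftDriver lam b) u k := by
  rw [dfield_apply, RadialLoewner.Disc.field_apply, disc_drivingPt_shiftDriver b hu]

/-- Unfolding of `kernel`. [folklore] -/
theorem kernel_apply (t : ℝ) (m : ℂ) :
    kernel lam t m = 2 * Real.exp t * m ^ 2 / (drivingPt lam t - Real.exp t * m) := rfl

/-- The kernel vanishes at `m = 0`. [folklore] -/
@[simp] theorem kernel_zero (t : ℝ) : kernel lam t 0 = 0 := by simp [kernel_apply]

/-- **The substitution `k = eᵗ m`**: `dfield λ t (eᵗ m) = eᵗ m + eᵗ · kernel λ t m`, i.e. if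
`ṁ = kernel λ t m` then `k = eᵗ m` solves `k̇ = dfield λ t k`. [folklore] -/
theorem dfield_exp_mul (t : ℝ) (m : ℂ) (h : drivingPt lam t - Real.exp t * m ≠ 0) :
    dfield lam t (Real.exp t * m) = Real.exp t * m + Real.exp t * kernel lam t m := by
  rw [dfield_apply, kernel_apply]
  field_simp
  ring

/-- **Inversion turns the interior field into the whole-plane field**: if `k ≠ 0` then
`-(dfield λ t k)/k² = WholePlaneLoewner.field λ t k⁻¹`, i.e. `g = 1/k` solves the whole-plane
Loewner equation `ġ = g (W + g)/(W - g)`, `W = e^{iλ}`, when `k̇ = dfield λ t k` (Lawler (2005),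
Remark 4.22; Miller–Sheffield (2013), §2.1.3). [cite: Lawler2005, Remark 4.22] -/
theorem inv_field_eq (t : ℝ) {k : ℂ} (hk : k ≠ 0) (hξ : drivingPt lam t - k ≠ 0) :
    -(dfield lam t k) / k ^ 2 = WholePlaneLoewner.field lam t k⁻¹ := by
  have hξ0 : drivingPt lam t ≠ 0 := drivingPt_ne_zero t
  have hW : exp ((lam t : ℂ) * I) = (drivingPt lam t)⁻¹ :=
    eq_inv_of_mul_eq_one_right (drivingPt_mul_exp t)
  have hkξ : k - drivingPt lam t ≠ 0 := fun h0 ↦ hξ (by rw [← neg_sub, h0, neg_zero])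
  rw [WholePlaneLoewner.field_apply, dfield_apply, hW]
  field_simp
  ring

/-! ### Trajectories: projections -/

section Traj

variable {w : ℂ} {k : ℝ → ℂ} {T T' : EReal}

/-- A trajectory solves the interior equation before its lifetime. [folklore] -/
theorem IsTraj.hasDerivAt (h : IsTraj lam w k T) {t : ℝ} (ht : (t : EReal) < T) :
    HasDerivAt k (dfield lam t (k t)) t := h.1 t ht

/-- A trajectory stays in the open unit disc before its lifetime. [folklore] -/
theorem IsTraj.norm_lt_one (h : IsTraj lam w k T) {t : ℝ} (ht : (t : EReal) < T) : ‖k t‖ < 1 :=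
  h.2.1 t ht

/-- The asymptotic initial value of a trajectory: `e^{-t} k t → w`. [folklore] -/
theorem IsTraj.tendsto (h : IsTraj lam w k T) :
    Tendsto (fun t : ℝ ↦ (Real.exp (-t) : ℂ) * k t) atBot (𝓝 w) := h.2.2

/-- A trajectory is off the driving point before its lifetime. [folklore] -/
theorem IsTraj.ne_drivingPt (h : IsTraj lam w k T) {t : ℝ} (ht : (t : EReal) < T) :
    k t ≠ drivingPt lam t :=
  ne_drivingPt_of_norm_lt_one (h.norm_lt_one ht) t

/-- Restricting the lifetime of a trajectory gives a trajectory. [folklore] -/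
theorem IsTraj.mono (h : IsTraj lam w k T) (hT : T' ≤ T) : IsTraj lam w k T' :=
  ⟨fun t ht ↦ h.1 t (ht.trans_le hT), fun t ht ↦ h.2.1 t (ht.trans_le hT), h.2.2⟩

/-- A trajectory is continuous at every time before its lifetime. [folklore] -/
theorem IsTraj.continuousAt (h : IsTraj lam w k T) {t : ℝ} (ht : (t : EReal) < T) :
    ContinuousAt k t :=
  (h.hasDerivAt ht).continuousAt

/-- The lifetime of a trajectory is bounded by the lifetime of its point. [folklore] -/
theorem IsTraj.le_lifetime (h : IsTraj lam w k T) : T ≤ lifetime lam w :=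
  le_sSup ⟨k, h⟩

/-- Two trajectories that agree before a lifetime can be exchanged. [folklore] -/
theorem IsTraj.congr (h : IsTraj lam w k T) {k' : ℝ → ℂ}
    (heq : ∀ t : ℝ, (t : EReal) < T → k' =ᶠ[𝓝 t] k) (hlim : k' =ᶠ[atBot] k) : IsTraj lam w k' T := by
  refine ⟨fun t ht ↦ ?_, fun t ht ↦ ?_, h.tendsto.congr' ?_⟩
  · rw [(heq t ht).self_of_nhds]
    exact (h.hasDerivAt ht).congr_of_eventuallyEq (heq t ht)
  · rw [(heq t ht).self_of_nhds]
    exact h.norm_lt_one ht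
  · filter_upwards [hlim] with t ht
    rw [ht]

/-- **The zero trajectory**: the constant `0` is a trajectory of `w = 0` with infinite lifetime
(`dfield λ t 0 = 0`); so `lifetime λ 0 = ⊤`. [folklore] -/
theorem isTraj_zero : IsTraj lam 0 (fun _ ↦ 0) ⊤ := by
  refine ⟨fun t _ ↦ ?_, fun t _ ↦ by simp, by simp⟩
  rw [dfield_zero]
  exact hasDerivAt_const t 0

/-- `lifetime λ 0 = ⊤`. [folklore] -/
theorem lifetime_zero : lifetime lam 0 = ⊤ :=
  eq_top_iff.2 isTraj_zero.le_lifetime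

end Traj

/-! ### Unfolding the exterior objects -/

/-- Membership in the whole-plane hull. [folklore] -/
theorem mem_hull_iff {t : ℝ} {z : ℂ} : z ∈ hull lam t ↔ z = 0 ∨ lifetime lam z⁻¹ ≤ (t : EReal) :=
  Iff.rfl

/-- The origin is in every hull. [folklore] -/
theorem zero_mem_hull (t : ℝ) : (0 : ℂ) ∈ hull lam t := Or.inl rfl

/-- Off the hull: `z ∉ Kₜ ↔ z ≠ 0 ∧ t < lifetime λ z⁻¹`, i.e. `z⁻¹ ∈ discDomain λ t`. [folklore] -/
theorem notMem_hull_iff {t : ℝ} {z : ℂ} : z ∉ hull lam t ↔ z ≠ 0 ∧ z⁻¹ ∈ discDomain lam t := by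
  rw [mem_hull_iff, not_or, not_le]
  rfl

/-- The hulls increase. [folklore] -/
theorem hull_mono : Monotone (hull lam) := by
  intro s t hst z hz
  rcases hz with hz | hz
  · exact Or.inl hz
  · exact Or.inr (hz.trans (EReal.coe_le_coe_iff.2 hst))

/-- Membership in the interior domain. [folklore] -/
theorem mem_discDomain_iff {t : ℝ} {w : ℂ} : w ∈ discDomain lam t ↔ (t : EReal) < lifetime lam w :=
  Iff.rfl

/-- `0 ∈ discDomain λ t` for every `t`. [folklore] -/
theorem zero_mem_discDomain (t : ℝ) : (0 : ℂ) ∈ discDomain lam t := by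
  rw [mem_discDomain_iff, lifetime_zero]
  exact EReal.coe_lt_top t

/-- The interior domains decrease. [folklore] -/
theorem discDomain_antitone : Antitone (discDomain lam) :=
  fun _ _ hst _ hw ↦ lt_of_le_of_lt (EReal.coe_le_coe_iff.2 hst) hw

/-- Unfolding of `map`. [folklore] -/
theorem map_apply (t : ℝ) (z : ℂ) : map lam t z = (traj lam z⁻¹ t)⁻¹ := rfl

end WholePlaneLoewner

end Literature.Probability.RandomPlanarGeometry
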